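import Literature.AlgebraicGeometry.Resolution.InseparableLocalUniformizationHeightBricks
import Literature.AlgebraicGeometry.Resolution.InseparableLocalUniformizationHeightValuations
import Literature.AlgebraicGeometry.Resolution.InseparableLocalUniformizationAlgebra
import Literature.AlgebraicGeometry.Resolution.InseparableLocalUniformizationEngine
import Literature.AlgebraicGeometry.Resolution.InseparableLocalUniformizationProofs
import Literature.AlgebraicGeometry.Resolution.InseparableLocalUniformizationDecompletion
import Mathlib.RingTheory.Ideal.Height
import HarnessLib

/-!
# Inseparable local uniformization, §4.2: Step 2 of the induction on the height, proved

Topic: `Literature/AlgebraicGeometry/Resolution`. M. Temkin, *Inseparable local uniformization*,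
J. Algebra 373 (2013) 65–119 = arXiv:0804.1554v3 (numbering of this version), §4.2 "Induction on
height" (pp. 50–51). Continuing `InseparableLocalUniformizationHeightBricks.lean`, this file
PROVES **Step 2 of §4.2** ("The theorem holds true if the condition of Step 1 is satisfied",
p. 51) from its printed inputs: Lemma 3.3.2 (`Temkin2013_Lemma332_nft`, the corrected
rendering of `InseparableLocalUniformizationDecompletion.lean` — the tree's older
`Temkin2013_Lemma332` lacks the lemma's "normalized finite type" hypothesis and is refutable),
Steps 3–4 of the proof of Thm. 4.1.1 (`Temkin2013_Steps34`,
`InseparableLocalUniformizationEngine.lean`) and Thm. 4.1.1 itself (`Temkin2013Descent`; "By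
Theorem 4.1.1 applied to `Y`, `k̄°` and `m°`"):

* `relConclusion_of_normalForm_nft` — PROVED: for data in the normal form produced by Step 1
  (`K° = O ⊆ O₁ = F°`; an intermediate field `k̄ ⊆ F°` finitely generated over `k` with
  `k̄° = K° ∩ k̄` of height one; an affine `k`-model `Y = Spec B` of `k̄°` inside `k̄`; a NORMAL
  affine model `X = Spec A` of `K°` containing `B`; and the centre `x` of `F°` on the generic
  fibre `X_η = Spec k̄[A]` a closed point (`k(x)` integral over `k̄`) which is simple `k̄`-smooth),
  the conclusion of (the corrected) Thm. 1.3.2 holds for `(k, K, K°, X)`. The proof follows the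
  text: `m = k(x)` with the valuation ring `m°` induced by `F̃°` (bricks file); `X_S =
  Nr_K(X ×_Y S)` as an affine normalized `S`-model with generic fibre `X_η` (bricks file and
  `adjoin_etaModel_eq`); Lemma 3.3.2; the refinement `X′ = Nr_K(A[f])` with
  `Nr_K(X′ ×_Y S) = X′_S` ("the argument from Step 2 in §4.1"); the smooth-equivalence is then
  the hypothesis of `Temkin2013_Steps34`, whose conclusion for `K₁ = K` is the conclusion of
  Thm. 1.3.2 for `X′`, hence for `X`. (`relConclusion_of_normalForm`, the same statement from the
  older refutable rendering `Temkin2013_Lemma332`, is kept only as a one-line corollary for the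
  files not yet re-plumbed.)
* Bricks for Step 1, PROVED: `ringKrullDim_le_of_lt` ("Let `F°` be the localization of `K°`
  whose height is `h - 1`": a proper coarsening of a valuation ring of height `≤ n + 1` has height
  `≤ n`), `valuationSubring_ne_top_of_not_ringKrullDim_le`, `algebra_isIntegral_quot_centreIdeal`
  (`k(x)` is integral over `k̄`), transports along equalities of subalgebras
  (`isSmoothAt_centreIdeal_congr`, `isSeparable_quot_centreIdeal_congr`), and finite-generation
  bookkeeping for intermediate fields.
* `Matsumura1987_26_9` — NAMED FACT (H. Matsumura, *Commutative Ring Theory*, Thm. 26.9: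
  separable = `0`-smooth), vendored for algebraic extensions: the dictionary between the two
  renderings of "simple" (`Algebra.FormallySmooth l k(𝔭)` in `Temkin2013RelConclusion`,
  `Algebra.IsSeparable k m` for the closed point of Lemma 3.3.2) needed by Step 1 to feed the
  induction hypothesis into the normal form; only the direction "formally smooth and algebraic
  ⇒ separable" is missing from Mathlib.

What remains for `Temkin2013HeightStepOfDescent` from printed inputs is Step 1 (the reduction
to the normal form by the induction hypothesis and the Step-0 transports), recorded in the
module docstring of `InseparableLocalUniformizationEngine.lean`.

## STATUS (verdict clean-up, 2026-08-16): `Temkin2013_Steps34` is deprecated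

The named fact `Temkin2013_Steps34` taken by `relConclusion_of_normalForm_nft` and
`relConclusion_of_normalForm` is MIS-RENDERED (its binders `[Algebra k̄ K₁] [IsScalarTower k̄ K
K₁]` leave the `k̄`-structure of `K₁` arbitrary, the tower hypothesis being the automatic one for
the action inherited from `K`) and is DEPRECATED in `InseparableLocalUniformizationEngine.lean`
(statement kept verbatim); its corrected rendering `Temkin2013_Steps34_tower`
(`InseparableLocalUniformizationEngineTower.lean`) is PROVED (`Temkin2013_Steps34_tower_holds`,
`…StepsThreeFourHolds.lean`). The proof below applies the fact with `K₁ = K` and the inherited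
structure only, and has been re-run on the corrected fact in
`InseparableLocalUniformizationHeightStepTwoTower.lean` (`relConclusion_of_normalForm_nft_tower`),
whence the unconditional `Temkin2013HeightStepOfDescent_holds`
(`…HeightStepOfDescentHolds.lean`). The two declarations naming `Temkin2013_Steps34` are kept
under their ledger-referenced names as a legacy layer, each switching `linter.deprecated` off for
itself alone; the bricks and `Matsumura1987_26_9` (discharged in `…HeightInduction.lean`) are
unaffected and remain in use.

## Sources

* M. Temkin, *Inseparable local uniformization*, arXiv:0804.1554v3, §4.2, Steps 1–2 (pp. 50–51);
  proof of Thm. 4.1.1, Step 2 (p. 48).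
* H. Matsumura, *Commutative Ring Theory*, Cambridge Univ. Press (1986/1989), Thm. 26.9.
-/

noncomputable section

open IsLocalRing

namespace Literature.AlgebraicGeometry.Resolution

universe u

/-! ### Separable = `0`-smooth for algebraic extensions (Matsumura, Thm. 26.9) -/

/-- NAMED FACT — **separable field extensions are exactly the `0`-smooth ones** (H. Matsumura,
*Commutative Ring Theory*, Thm. 26.9: a field extension `L/K` is separable if and only if `L`
is `0`-smooth (= formally smooth) over `K`), vendored in the ALGEBRAIC case, where "separable"
is Mathlib's `Algebra.IsSeparable` (every element separable algebraic); the direction "⇐" for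
algebraic separable extensions is Mathlib's `Algebra.FormallyEtale.of_isSeparable`, the
direction "⇒" (a formally smooth algebraic extension is separable) is not in Mathlib. This is
the dictionary between the two renderings of Temkin's "simple point" (`k(x)/l` separable,
Temkin 2013, p. 4) used in this development: `Algebra.FormallySmooth l k(𝔭)` in
`Temkin2013RelConclusion` (residue fields of centres are in general transcendental over `l`) and
`Algebra.IsSeparable k m` in `Temkin2013_Lemma332_nft` (a closed point: `m/k` finite). Users
take `(h : Matsumura1987_26_9)`. [cite: Matsumura1987, Thm. 26.9] -/
def Matsumura1987_26_9 : Prop :=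
  ∀ (K L : Type u) [Field K] [Field L] [Algebra K L], Algebra.IsAlgebraic K L →
    (Algebra.FormallySmooth K L ↔ Algebra.IsSeparable K L)

section closedPointIntegral

variable {k K : Type u} [Field k] [Field K] [Algebra k K]
variable (O₁ : ValuationSubring K) (kb : IntermediateField k K)
  (Aη : Subalgebra kb K) (hA : Aη.toSubring ≤ O₁.toSubring)

/-- `k(x) = A_η/x` is integral over `k̄` when `F̃` is algebraic over the residues of `k̄ ⊆ F°`
(transfer of algebraicity along `k(x) ↪ F̃` and `k̄ ↠ k̄P`). [folklore] -/
theorem algebra_isIntegral_quot_centreIdeal (hkb : ∀ c : kb, (c : K) ∈ O₁)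
    (hres : IsResiduallyAlgebraicOver O₁ kb.toSubfield ⊤) :
    Algebra.IsIntegral kb (Aη ⧸ centreIdeal Aη O₁ hA) := by
  refine ⟨fun a => IsAlgebraic.isIntegral ?_⟩
  obtain ⟨a, rfl⟩ := Ideal.Quotient.mk_surjective a
  refine IsAlgebraic.of_ringHom_of_comp_eq (toResField O₁ kb hkb)
    (quotCentreToResidueField O₁ kb Aη hA) ?_ (toResField_surjective O₁ kb hkb)
    (quotCentreToResidueField_injective O₁ kb Aη hA) ?_
  · rw [quotCentreToResidueField_mk]
    exact hres _ (residue_mem_resField O₁ _ (Subfield.mem_top _))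
  · ext c
    rfl

end closedPointIntegral

section genericFibre

variable {k K : Type u} [Field k] [Field K] [Algebra k K]
variable {kb : Type u} [Field kb] [Algebra kb K]

/-- **The generic fibre of `X_S` is that of `X`**: `k̄[Nr_K(X ×_Y S)] = k̄[A]` when `X = Spec A`
is normal and contains an affine `k`-model `B` of the base field `k̄ = Frac B` (Temkin 2013,
§4.2, Step 2, p. 51: "its `η`-fiber is isomorphic to `X_η` (we use that `X_η` is normal because
`X` is so)"). [cite: Temkin2013, Section 4.2, Step 2 (p. 51)] -/
theorem adjoin_etaModel_eq (A : Subalgebra k K) (hAn : ∀ x : K, IsIntegral A x → x ∈ A)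
    (B : Subring kb) (hB : ∀ z : kb, ∃ a ∈ B, ∃ b ∈ B, z = a / b)
    (hBA : B.map (algebraMap kb K) ≤ A.toSubring) (R₀ : Subring kb) :
    Algebra.adjoin kb (etaModel kb (nrIn A.toSubring) R₀ : Set K) =
      Algebra.adjoin kb (A : Set K) := by
  have hAn' : ∀ x : K, IsIntegral A.toSubring x → x ∈ A.toSubring := hAn
  refine le_antisymm (Algebra.adjoin_le fun x hx => ?_)
    (Algebra.adjoin_mono ((le_nrIn A.toSubring).trans (le_etaModel _ _)))
  -- `x ∈ Nr_K(Nr_K(A)·R₀)` is integral over `k̄[A]`, which is integrally closed in `K`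
  apply mem_adjoin_of_isIntegral_adjoin B hB A.toSubring hBA hAn'
  have hle : nrIn A.toSubring ⊔ R₀.map (algebraMap kb K) ≤
      (Algebra.adjoin kb (A.toSubring : Set K)).toSubring := by
    refine sup_le ?_ ?_
    · rw [nrIn_eq_self_of_normal hAn']
      intro a ha
      exact Algebra.subset_adjoin ha
    · rintro _ ⟨c, -, rfl⟩
      exact Subalgebra.algebraMap_mem _ c
  letI : Algebra ↥(nrIn A.toSubring ⊔ R₀.map (algebraMap kb K))
      (Algebra.adjoin kb (A.toSubring : Set K)) := (Subring.inclusion hle).toAlgebra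
  haveI : IsScalarTower ↥(nrIn A.toSubring ⊔ R₀.map (algebraMap kb K))
      (Algebra.adjoin kb (A.toSubring : Set K)) K := IsScalarTower.of_algebraMap_eq (fun _ => rfl)
  exact (mem_nrIn_iff.mp hx).tower_top

end genericFibre

/-! ### Transport along equalities of subalgebras / subrings -/

section congr

variable {k K : Type u} [Field k] [Field K] [Algebra k K]

/-- Smoothness of the centre is invariant under rewriting the model along an equality of
subalgebras. [folklore] -/
theorem isSmoothAt_centreIdeal_congr {F : Type u} [Field F] [Algebra F K] {S₁ S₂ : Subalgebra F K}
    (heq : S₁ = S₂) (O' : ValuationSubring K) (h₁ : S₁.toSubring ≤ O'.toSubring)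
    (h₂ : S₂.toSubring ≤ O'.toSubring) :
    Algebra.IsSmoothAt F (centreIdeal S₁ O' h₁) ↔ Algebra.IsSmoothAt F (centreIdeal S₂ O' h₂) := by
  subst heq; exact Iff.rfl

/-- Separability of the residue field of the centre is invariant under rewriting the model along
an equality of subalgebras. [folklore] -/
theorem isSeparable_quot_centreIdeal_congr {F : Type u} [Field F] [Algebra F K]
    {S₁ S₂ : Subalgebra F K} (heq : S₁ = S₂) (O' : ValuationSubring K)
    (h₁ : S₁.toSubring ≤ O'.toSubring) (h₂ : S₂.toSubring ≤ O'.toSubring) :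
    Algebra.IsSeparable F (S₁ ⧸ centreIdeal S₁ O' h₁) ↔
      Algebra.IsSeparable F (S₂ ⧸ centreIdeal S₂ O' h₂) := by
  subst heq; exact Iff.rfl

/-- The field range of the inclusion of an intermediate field. [folklore] -/
theorem fieldRange_algebraMap_intermediateField (kb : IntermediateField k K) :
    (algebraMap kb K).fieldRange = kb.toSubfield := by
  ext x
  constructor
  · rintro ⟨c, rfl⟩; exact c.2
  · intro hx; exact ⟨⟨x, hx⟩, rfl⟩

end congr

/-! ### The coarsening of height `h - 1` -/

section coarseningDim

variable {K : Type u} [Field K]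

/-- **A proper coarsening has smaller height** (Temkin 2013, §4.2, p. 50: "Let `F°` be the
localization of `K°` whose height is `h - 1`"): if `O < O₁` and `K°= O` has height `≤ n + 1`,
then `O₁ = O_P` for the prime `P = 𝔪_{O₁} ∩ O < 𝔪_O`, whose height is `< ht 𝔪_O ≤ n + 1`.
[cite: Temkin2013, Section 4.2 (p. 50)] -/
theorem ringKrullDim_le_of_lt (O O₁ : ValuationSubring K) (hlt : O < O₁) (n : ℕ)
    (hdim : ringKrullDim O ≤ (n + 1 : ℕ)) : ringKrullDim O₁ ≤ n := by
  set P := O.idealOfLE O₁ hlt.le with hP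
  haveI : P.IsPrime := inferInstance
  have hO₁ : O.ofPrime P = O₁ := ValuationSubring.ofPrime_idealOfLE O O₁ hlt.le
  -- `P ≠ 𝔪`: an element `x ∈ O₁ ∖ O` has `x⁻¹ ∈ 𝔪_O` but `x⁻¹ ∉ 𝔪_{O₁}`
  have hPne : P ≠ maximalIdeal O := fun heq => by
    obtain ⟨x, hxO₁, hxO⟩ := SetLike.exists_of_lt hlt
    have hx0 : x ≠ 0 := fun h0 => hxO (h0 ▸ O.zero_mem)
    have hxi : x⁻¹ ∈ O := (O.mem_or_inv_mem x).resolve_left hxO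
    have hxim : (⟨x⁻¹, hxi⟩ : O) ∈ maximalIdeal O := by
      rw [IsLocalRing.mem_maximalIdeal, mem_nonunits_iff]
      intro hu
      apply hxO
      have := inv_mem_of_isUnit O hxi hu
      rwa [inv_inv] at this
    rw [← heq] at hxim
    have hxim' : (⟨x⁻¹, hlt.le hxi⟩ : O₁) ∈ maximalIdeal O₁ := hxim
    rw [IsLocalRing.mem_maximalIdeal, mem_nonunits_iff] at hxim'
    exact hxim' (isUnit_of_inv_mem O₁ (hlt.le hxi) (by rw [inv_inv]; exact hxO₁) (inv_ne_zero hx0))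
  have hPlt : P < maximalIdeal O :=
    lt_of_le_of_ne (IsLocalRing.le_maximalIdeal (Ideal.IsPrime.ne_top ‹_›)) hPne
  -- finite dimension
  haveI : FiniteRingKrullDim O := by
    refine finiteRingKrullDim_iff_ne_bot_and_top.mpr ⟨?_, ?_⟩
    · exact ne_bot_of_le_ne_bot (by simp) (ringKrullDim_nonneg_of_nontrivial (R := O))
    · refine ne_top_of_le_ne_top ?_ hdim
      have h1 : (((n + 1 : ℕ) : ℕ∞) : WithBot ℕ∞) < ((⊤ : ℕ∞) : WithBot ℕ∞) :=
        WithBot.coe_lt_coe.mpr (ENat.coe_lt_top (n + 1))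
      exact ne_of_lt h1
  have hht : P.height < (maximalIdeal O).height := Ideal.height_strict_mono_of_isPrime_of_isPrime hPlt
  have hmax : ((maximalIdeal O).height : WithBot ℕ∞) = ringKrullDim O :=
    IsLocalRing.maximalIdeal_height_eq_ringKrullDim
  have hdimP : ringKrullDim (O.ofPrime P) = P.height :=
    IsLocalization.AtPrime.ringKrullDim_eq_height P (O.ofPrime P)
  rw [← hO₁, hdimP]
  -- `P.height < 𝔪.height ≤ n + 1`
  have h2 : (maximalIdeal O).height ≤ (n + 1 : ℕ) := by
    have := hmax.le.trans hdim
    exact_mod_cast this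
  have h3 : P.height < (n + 1 : ℕ) := lt_of_lt_of_le hht h2
  have h4 : P.height ≤ n := by
    rw [Nat.cast_succ] at h3
    exact Order.le_of_lt_add_one h3
  exact_mod_cast h4

end coarseningDim

/-! ### Small valuation-theoretic and field-theoretic bookkeeping for Step 1 -/

section stepOnePrelim

variable {k K : Type u} [Field k] [Field K] [Algebra k K]

/-- A valuation ring of positive height is not the whole field: `K` itself (`⊤`) has Krull
dimension `0`. [folklore] -/
theorem valuationSubring_ne_top_of_not_ringKrullDim_le (O : ValuationSubring K) (n : ℕ)
    (h : ¬ ringKrullDim O ≤ n) : O ≠ ⊤ := by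
  rintro rfl
  apply h
  haveI : Ring.KrullDimLE 0 (⊤ : ValuationSubring K) := by
    refine Ring.KrullDimLE.mk₀ fun I hI => ?_
    rw [Ideal.isMaximal_iff]
    refine ⟨fun h1 => hI.ne_top ((Ideal.eq_top_iff_one I).mpr h1), fun J x hIJ hxI hxJ => ?_⟩
    have hx0 : (x : K) ≠ 0 := fun h0 => hxI (by
      have : x = 0 := Subtype.ext h0
      rw [this]; exact I.zero_mem)
    have hunit : IsUnit x :=
      isUnit_of_inv_mem ⊤ x.2 (ValuationSubring.mem_top _) hx0
    exact J.eq_top_of_isUnit_mem hxJ hunit ▸ Submodule.mem_top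
  have h0 : ringKrullDim (⊤ : ValuationSubring K) ≤ (0 : ℕ) := Ring.krullDimLE_iff.mp ‹_›
  exact h0.trans (by exact_mod_cast Nat.zero_le n)

/-- A `k̄`-subalgebra generated by a subset of a valuation ring containing `k̄` lies in it.
[folklore] -/
theorem adjoin_toSubring_le_valuationSubring (kb : IntermediateField k K) (O₁ : ValuationSubring K)
    (hkb : ∀ c : kb, (c : K) ∈ O₁) (S : Set K) (hS : S ⊆ O₁) :
    (Algebra.adjoin kb S).toSubring ≤ O₁.toSubring := by
  let O₁alg : Subalgebra kb K :=
    { O₁.toSubring.toSubsemiring with algebraMap_mem' := fun c => hkb c }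
  have : Algebra.adjoin kb S ≤ O₁alg := Algebra.adjoin_le hS
  exact fun x hx => this hx

/-- `k̄[A]` is finitely generated over `k̄` and has fraction field `K` when `A` does.
[folklore] -/
theorem adjoin_fg_and_isFractionRing (kb : IntermediateField k K) (A : Subalgebra k K)
    (hAfg : A.FG) (hAfr : IsFractionRing A K) :
    (Algebra.adjoin kb (A : Set K)).FG ∧ IsFractionRing (Algebra.adjoin kb (A : Set K)) K := by
  obtain ⟨t, ht⟩ := hAfg
  refine ⟨⟨t, by rw [← ht, Algebra.adjoin_adjoin_of_tower]⟩, ?_⟩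
  haveI := hAfr
  refine IsFractionRing.of_field _ K fun z => ?_
  obtain ⟨a, b, -, rfl⟩ := IsFractionRing.div_surjective (A := A) z
  exact ⟨⟨a, Algebra.subset_adjoin a.2⟩, ⟨b, Algebra.subset_adjoin b.2⟩, rfl⟩

/-- Finite generation of the top intermediate field passes to an intermediate base: if `K/k`
is finitely generated then so is `K/k̄` for every intermediate field `k̄`. [folklore] -/
theorem intermediateField_fg_top_of_fg_top (kb : IntermediateField k K)
    (hfg : (⊤ : IntermediateField k K).FG) : (⊤ : IntermediateField kb K).FG := by
  haveI : Algebra.EssFiniteType k K := IntermediateField.fg_top_iff.mp hfg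
  haveI : Algebra.EssFiniteType kb K := Algebra.EssFiniteType.of_comp k kb K
  exact IntermediateField.fg_top_iff.mpr ‹_›

/-- An intermediate field which is finitely generated (as an intermediate field) is finitely
generated over the ground field in the sense of `(⊤ : IntermediateField k k̄).FG`. [folklore] -/
theorem intermediateField_fg_top_of_fg (kb : IntermediateField k K) (hkb : kb.FG) :
    (⊤ : IntermediateField k kb).FG :=
  IntermediateField.fg_top_iff.mpr (IntermediateField.essFiniteType_iff.mpr hkb)

end stepOnePrelim

/-! ### Step 2 of §4.2: the theorem in normal form -/

section stepTwo

variable {k K : Type u} [Field k] [Field K] [Algebra k K]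

-- the final transport of Lemma 3.3.2's smooth-equivalence into the shape of `Temkin2013_Steps34`
-- unfolds several `codRestrict`/`etaModelBaseMap` definitions (twice the default budget)
-- `linter.deprecated` is switched off for the next declaration only (verdict clean-up
-- 2026-08-16): it names, as a hypothesis, the MIS-RENDERED fact `Temkin2013_Steps34`, deprecated
-- in `InseparableLocalUniformizationEngine.lean` in favour of the PROVED corrected rendering
-- `Temkin2013_Steps34_tower` / `Temkin2013_Steps34_tower_holds`; kept for its legacy users (see
-- the module docstring, STATUS, for the unconditional counterparts).
set_option linter.deprecated false in
set_option maxHeartbeats 400000 in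
/-- **Step 2 of the induction on the height** (Temkin 2013, §4.2, Step 2, p. 51: "The theorem
holds true if the condition of Step 1 is satisfied"), PROVED from Lemma 3.3.2 (the corrected
rendering `Temkin2013_Lemma332_nft`, whose finiteness hypothesis "`K/k̄` finitely generated" holds
here as `K/k` is), Steps 3–4 of the proof of Thm. 4.1.1 (`Temkin2013_Steps34`) and
Thm. 4.1.1 (`Temkin2013Descent`, "By Theorem 4.1.1 applied to `Y`, `k̄°` and `m°`"). The
"condition of Step 1" (normal form): `K° = O ⊆ O₁ = F°`; `k̄` an intermediate field, finitely
generated over `k`, with `k̄° = K° ∩ k̄` of height one; `Y = Spec B` an affine `k`-model of `k̄°`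
inside `k̄`; `X = Spec A` a NORMAL affine model of `K°` containing `B`; and the centre `x` of `F°`
on the generic fibre `X_η = Spec k̄[A]` a closed point (`k(x) = k̄[A]/x` integral over `k̄`) which
is simple (`k(x)/k̄` separable) and `k̄`-smooth. Conclusion: the conclusion of (the corrected)
Thm. 1.3.2 for `(k, K, K°, X)`.
[cite: Temkin2013, Section 4.2, Step 2 (arXiv:0804.1554v3 p. 51)] -/
theorem relConclusion_of_normalForm_nft (h332 : Temkin2013_Lemma332_nft.{u})
    (h34 : Temkin2013_Steps34.{u}) (hD : Temkin2013Descent.{u})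
    (hfg : (⊤ : IntermediateField k K).FG) (O : ValuationSubring K)
    (hk : ∀ c : k, algebraMap k K c ∈ O) (O₁ : ValuationSubring K) (h01 : O ≤ O₁)
    (kb : IntermediateField k K) (hkbfg : (⊤ : IntermediateField k kb).FG)
    (hdim1 : ringKrullDim (O.comap (algebraMap kb K)) = 1)
    (B : Subalgebra k kb) (hBO : B.toSubring ≤ (O.comap (algebraMap kb K)).toSubring)
    (hBfg : B.FG) (hBfr : IsFractionRing B kb)
    (A : Subalgebra k K) (hAO : A.toSubring ≤ O.toSubring) (hAfg : A.FG)
    (hAfr : IsFractionRing A K) (hAn : ∀ x : K, IsIntegral A x → x ∈ A)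
    (hBA : ∀ b : B, algebraMap kb K b ∈ A)
    (hAη : (Algebra.adjoin kb (A : Set K)).toSubring ≤ O₁.toSubring)
    (hint : Algebra.IsIntegral kb
      (↥(Algebra.adjoin kb (A : Set K)) ⧸ centreIdeal (Algebra.adjoin kb (A : Set K)) O₁ hAη))
    (hsm : Algebra.IsSmoothAt kb (centreIdeal (Algebra.adjoin kb (A : Set K)) O₁ hAη))
    (hsep : Algebra.IsSeparable kb
      (↥(Algebra.adjoin kb (A : Set K)) ⧸ centreIdeal (Algebra.adjoin kb (A : Set K)) O₁ hAη)) :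
    Temkin2013RelConclusion k K O A := by
  classical
  -- the base valuation ring `k̄° = K° ∩ k̄`, of height one and equal characteristic
  set Okb : ValuationSubring kb := O.comap (algebraMap kb K) with hOkb
  have hdimle : ringKrullDim Okb ≤ 1 := hdim1.le
  have hkOkb : ∀ c : k, algebraMap k kb c ∈ Okb := fun c => by
    change algebraMap kb K (algebraMap k kb c) ∈ O
    rw [← IsScalarTower.algebraMap_apply]; exact hk c
  have hchar : ringChar (IsLocalRing.ResidueField Okb) = ringChar kb :=
    ringChar_residueField_eq_of_algebraMap_mem Okb hkOkb
  -- the closed point `x` and its residue field `m = k(x)`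
  set Aη : Subalgebra kb K := Algebra.adjoin kb (A : Set K) with hAηdef
  set x := centreIdeal Aη O₁ hAη with hxdef
  haveI : Algebra.IsIntegral kb (Aη ⧸ x) := hint
  haveI hxmax : x.IsMaximal := Ideal.Quotient.maximal_of_isField _
    (isField_of_isIntegral_of_isField' (R := kb) (S := Aη ⧸ x) (Field.toIsField kb))
  letI : Field (Aη ⧸ x) := Ideal.Quotient.field x
  let φ : Aη →ₐ[kb] Aη ⧸ x := Ideal.Quotient.mkₐ kb x
  have hφ : Function.Surjective φ := Ideal.Quotient.mkₐ_surjective kb x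
  let ψ := quotCentreToResidueField O₁ kb Aη hAη
  have hψφ : ∀ a : Aη, ψ (φ a) = residue O₁ ⟨(a : K), hAη a.2⟩ := fun a => rfl
  let Om : ValuationSubring (Aη ⧸ x) := residuePointValuationSubring O O₁ h01 ψ
  have hOm : Om.comap (algebraMap kb (Aη ⧸ x)) = Okb :=
    residuePointValuationSubring_comap O O₁ h01 kb Aη hAη φ ψ hψφ
  -- `X_S = Nr_K(X ×_Y S)`, an affine normalized `S`-model with generic fibre `X_η`
  set R₀ : Subring kb := Okb.toSubring with hR₀
  have hR₀O : ∀ c ∈ R₀, algebraMap kb K c ∈ O := fun c hc => hc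
  obtain ⟨t, ht⟩ := hAfg
  set XS : Subring K := etaModel kb (nrIn A.toSubring) R₀ with hXSdef
  have hXSmodel : IsAffineNormalizedModel ⊤ (R₀.map (algebraMap kb K)) XS :=
    isAffineNormalizedModel_etaModel A t ht hAfr R₀ hkOkb
  have hXSO : XS ≤ O.toSubring := etaModel_le_valuationSubring A O hAO R₀ hR₀O
  have hB' : ∀ z : kb, ∃ a ∈ B.toSubring, ∃ b ∈ B.toSubring, z = a / b := fun z => by
    haveI := hBfr
    obtain ⟨a, b, -, rfl⟩ := IsFractionRing.div_surjective (A := B) z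
    exact ⟨a, a.2, b, b.2, rfl⟩
  have hBA' : B.toSubring.map (algebraMap kb K) ≤ A.toSubring := by
    rintro _ ⟨b, hb, rfl⟩; exact hBA ⟨b, hb⟩
  have hadj : Algebra.adjoin kb (XS : Set K) = Aη := adjoin_etaModel_eq A hAn B.toSubring hB' hBA' R₀
  have hAη' : (Algebra.adjoin kb (XS : Set K)).toSubring ≤ O₁.toSubring := by rw [hadj]; exact hAη
  -- Lemma 3.3.2's data in terms of `k̄[X_S]`
  let e : Algebra.adjoin kb (XS : Set K) ≃ₐ[kb] Aη := Subalgebra.equivOfEq _ _ hadj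
  have he : ∀ a : Algebra.adjoin kb (XS : Set K), (e a : K) = a := fun a => rfl
  let φ' : Algebra.adjoin kb (XS : Set K) →ₐ[kb] Aη ⧸ x := φ.comp e.toAlgHom
  have hφ' : Function.Surjective φ' := hφ.comp e.surjective
  set x' : Ideal (Algebra.adjoin kb (XS : Set K)) := centreIdeal _ O₁ hAη' with hx'def
  have hker' : RingHom.ker (φ' : Algebra.adjoin kb (XS : Set K) →+* Aη ⧸ x) = x' := by
    ext a
    rw [RingHom.mem_ker]
    change Ideal.Quotient.mk x (e a) = 0 ↔ a ∈ x'
    rw [Ideal.Quotient.eq_zero_iff_mem]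
    rfl
  have hsm' : Algebra.IsSmoothAt kb x' := (isSmoothAt_centreIdeal_congr hadj O₁ hAη' hAη).mpr hsm
  have hiA : ∀ a : XS, φ' ⟨a, Algebra.subset_adjoin a.2⟩ ∈ Om := fun a =>
    (map_mem_residuePointValuationSubring_iff O O₁ h01 kb Aη hAη φ ψ hψφ _).mpr (hXSO a.2)
  obtain ⟨A'S, hXA', hA'model, hA'le, hi', hkA', hkm, hASE⟩ :=
    h332 kb K Okb hchar hdim1 XS hXSmodel (intermediateField_fg_top_of_fg_top kb hfg) (Aη ⧸ x) φ'
      hφ' x' hker' hsm' hsep Om hOm hiA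
  -- `A′_S ⊆ K°` (its image in `m` lies in `m°`)
  have hA'SO : A'S ≤ O.toSubring := fun a ha =>
    (map_mem_residuePointValuationSubring_iff O O₁ h01 kb Aη hAη φ ψ hψφ
      (e ⟨a, hA'le a ha⟩)).mp (hi' ⟨a, ha⟩)
  -- the refinement `X′ = Nr_K(A[f])` of `X` with `Nr_K(X′ ×_Y S) = A′_S`
  obtain ⟨s', -, hA'Sset, -⟩ := hA'model
  obtain ⟨C', hC'⟩ : ∃ C' : Subring K,
      C' = Subring.closure (↑(R₀.map (algebraMap kb K)) ∪ (s' : Set K)) := ⟨_, rfl⟩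
  have hA'SC' : A'S = nrIn C' := by
    apply SetLike.coe_injective
    rw [hA'Sset, hC']
    rfl
  have hs'A'S : (s' : Set K) ⊆ A'S := fun y hy => by
    rw [hA'SC']
    exact le_nrIn C' (by rw [hC']; exact Subring.subset_closure (Or.inr hy))
  have htA : (t : Set K) ⊆ A := by rw [← ht]; exact Algebra.subset_adjoin
  set A₁ : Subalgebra k K := Algebra.adjoin k (↑t ∪ ↑s') with hA₁def
  have hAA₁ : A ≤ A₁ := by rw [← ht]; exact Algebra.adjoin_mono Set.subset_union_left
  have hA₁fg : A₁.FG := ⟨t ∪ s', by rw [Finset.coe_union]⟩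
  let Oalg : Subalgebra k K := { O.toSubring.toSubsemiring with algebraMap_mem' := hk }
  have hA₁O : A₁.toSubring ≤ O.toSubring := by
    have : A₁ ≤ Oalg := Algebra.adjoin_le (Set.union_subset (htA.trans hAO)
      (hs'A'S.trans hA'SO))
    exact fun y hy => this hy
  have hA₁fr : IsFractionRing A₁ K := by
    haveI := hAfr
    refine IsFractionRing.of_field A₁ K fun z => ?_
    obtain ⟨a, b, -, rfl⟩ := IsFractionRing.div_surjective (A := A) z
    exact ⟨⟨a, hAA₁ a.2⟩, ⟨b, hAA₁ b.2⟩, rfl⟩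
  obtain ⟨A₂, hA₁A₂, hA₂O, hA₂fg, hA₂fr, hA₂n, hA₂set⟩ :=
    exists_normal_affineModel_ge' O A₁ hA₁O hA₁fg hA₁fr
  have hAA₂ : A ≤ A₂ := hAA₁.trans hA₁A₂
  have hBA₂ : ∀ b : B, algebraMap kb K b ∈ A₂ := fun b => hAA₂ (hBA b)
  -- `etaModel k̄ (Nr_K A₂) k̄° = A′_S`
  have hA₂nr : A₂.toSubring = nrIn A₁.toSubring := by
    apply SetLike.coe_injective
    change (A₂ : Set K) = (nrIn A₁.toSubring : Set K)
    rw [hA₂set]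
    rfl
  have hkey : etaModel kb (nrIn (A₂.toSubring.map (algebraMap K K))) R₀ = A'S := by
    rw [subring_map_algebraMap_self, hA₂nr, nrIn_nrIn, hA'SC']
    refine nrIn_eq_nrIn_of_le_of_le (sup_le ?_ ?_) ?_
    · -- `Nr_K(A₁) ≤ Nr_K(C′)` since `A₁ = k[t, s′] ⊆ Nr_K(C′)`
      have h1 : A₁.toSubring ≤ nrIn C' := by
        rw [hA₁def, Algebra.adjoin_eq_ring_closure, Subring.closure_le]
        rintro y (⟨c, rfl⟩ | hy | hy)
        · refine le_nrIn C' ?_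
          rw [hC']
          refine Subring.subset_closure (Or.inl ⟨algebraMap k kb c, hkOkb c, ?_⟩)
          exact (IsScalarTower.algebraMap_apply k kb K c).symm
        · rw [← hA'SC']; exact hXA' (le_etaModel _ _ (le_nrIn _ (htA hy)))
        · rw [← hA'SC']; exact hs'A'S hy
      have h2 := nrIn_mono h1
      rwa [nrIn_nrIn] at h2
    · refine (le_nrIn C').trans' ?_
      rw [hC']; exact fun y hy => Subring.subset_closure (Or.inl hy)
    · refine (le_nrIn _).trans' ?_
      rw [hC', Subring.closure_le]
      refine Set.union_subset (fun y hy => (le_sup_right : R₀.map (algebraMap kb K) ≤ _) hy)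
        fun y hy => (le_sup_left : nrIn A₁.toSubring ≤ _) (le_nrIn _ ?_)
      exact Algebra.subset_adjoin (Or.inr hy)
  -- Steps 3–4 (`Temkin2013_Steps34`) for `X′ = Spec A₂`, `K₁ = K`, `m = k(x)`, `m°`
  have hDY : Temkin2013DescentFor k kb Okb := hD k kb hkbfg Okb hkOkb hdimle
  have hAηfg : Aη.FG := ⟨t, by rw [hAηdef, ← ht, Algebra.adjoin_adjoin_of_tower]⟩
  haveI : Algebra.FiniteType kb Aη := (Subalgebra.fg_iff_finiteType _).mp hAηfg
  haveI : Algebra.FiniteType kb (Aη ⧸ x) := Algebra.FiniteType.of_surjective φ hφ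
  haveI : FiniteDimensional kb (Aη ⧸ x) := Algebra.IsIntegral.finite
  have hOcomap : O.comap (algebraMap K K) = O := by ext; rfl
  have hXS₂ : etaModel kb (nrIn (A₂.toSubring.map (algebraMap K K))) Okb.toSubring ≤
      O.toSubring := by rw [hkey]; exact hA'SO
  have hOm₂ : ∀ c : Okb.toSubring, algebraMap kb (Aη ⧸ x) c ∈ Om := fun c => by
    have : (c : kb) ∈ Om.comap (algebraMap kb (Aη ⧸ x)) := by rw [hOm]; exact c.2
    exact this
  -- the smooth-equivalence hypothesis of `Temkin2013_Steps34`, transported from Lemma 3.3.2's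
  have hASE₂ : AreSmoothEquivalent
      (etaModelBaseMap (nrIn (A₂.toSubring.map (algebraMap K K))) Okb.toSubring)
      (((algebraMap kb (Aη ⧸ x)).comp Okb.toSubring.subtype).codRestrict Om hOm₂)
      ((IsLocalRing.maximalIdeal O).comap (Subring.inclusion hXS₂))
      (IsLocalRing.maximalIdeal Om) := by
    subst hkey
    have hpt : (IsLocalRing.maximalIdeal Om).comap
        (liftToValuationSubring (Algebra.adjoin kb (XS : Set K)) φ' _ hA'le Om hi') =
        (IsLocalRing.maximalIdeal O).comap (Subring.inclusion hXS₂) := by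
      refine Ideal.ext fun a => ?_
      rw [Ideal.mem_comap, Ideal.mem_comap]
      exact map_mem_maximalIdeal_residuePoint_iff O O₁ h01 kb Aη hAη φ ψ hψφ
        (e ⟨a, hA'le a a.2⟩) (hA'SO a.2)
    rw [← hpt]
    exact hASE
  have hconcl := h34 k K hfg O hk kb hkbfg hdimle hDY B hBO hBfg hBfr A₂ hA₂O hA₂fg hA₂fr hA₂n
    hBA₂ K inferInstance O hOcomap (Aη ⧸ x) inferInstance Om hOm hXS₂ hOm₂ hASE₂
  exact Temkin2013RelConclusion.of_le O hAA₂
    (Temkin2013DescentConclusion.relConclusion_self O A₂ hconcl)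

-- `linter.deprecated` off for the next declaration only (same reason: its hypothesis is the
-- deprecated `Temkin2013_Steps34`; see the first such switch in this file).
set_option linter.deprecated false in
/-- `relConclusion_of_normalForm_nft` with Lemma 3.3.2 taken in the tree's OLDER rendering
`Temkin2013_Lemma332`, which lacks the printed "normalized finite type" hypothesis and is
refutable (see `InseparableLocalUniformizationDecompletion.lean`); this corollary (via
`Temkin2013_Lemma332_nft.of_lemma332`) only keeps files written against the old signature
compiling until they are re-plumbed, and should not be used as genuine input.
[cite: Temkin2013, Section 4.2, Step 2 (arXiv:0804.1554v3 p. 51)] -/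
theorem relConclusion_of_normalForm (h332 : Temkin2013_Lemma332.{u}) (h34 : Temkin2013_Steps34.{u})
    (hD : Temkin2013Descent.{u})
    (hfg : (⊤ : IntermediateField k K).FG) (O : ValuationSubring K)
    (hk : ∀ c : k, algebraMap k K c ∈ O) (O₁ : ValuationSubring K) (h01 : O ≤ O₁)
    (kb : IntermediateField k K) (hkbfg : (⊤ : IntermediateField k kb).FG)
    (hdim1 : ringKrullDim (O.comap (algebraMap kb K)) = 1)
    (B : Subalgebra k kb) (hBO : B.toSubring ≤ (O.comap (algebraMap kb K)).toSubring)
    (hBfg : B.FG) (hBfr : IsFractionRing B kb)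
    (A : Subalgebra k K) (hAO : A.toSubring ≤ O.toSubring) (hAfg : A.FG)
    (hAfr : IsFractionRing A K) (hAn : ∀ x : K, IsIntegral A x → x ∈ A)
    (hBA : ∀ b : B, algebraMap kb K b ∈ A)
    (hAη : (Algebra.adjoin kb (A : Set K)).toSubring ≤ O₁.toSubring)
    (hint : Algebra.IsIntegral kb
      (↥(Algebra.adjoin kb (A : Set K)) ⧸ centreIdeal (Algebra.adjoin kb (A : Set K)) O₁ hAη))
    (hsm : Algebra.IsSmoothAt kb (centreIdeal (Algebra.adjoin kb (A : Set K)) O₁ hAη))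
    (hsep : Algebra.IsSeparable kb
      (↥(Algebra.adjoin kb (A : Set K)) ⧸ centreIdeal (Algebra.adjoin kb (A : Set K)) O₁ hAη)) :
    Temkin2013RelConclusion k K O A :=
  relConclusion_of_normalForm_nft (Temkin2013_Lemma332_nft.of_lemma332 h332) h34 hD hfg O hk O₁
    h01 kb hkbfg hdim1 B hBO hBfg hBfr A hAO hAfg hAfr hAn hBA hAη hint hsm hsep

end stepTwo

end Literature.AlgebraicGeometry.Resolution
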